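import Literature.AnabelianGeometry.AbsoluteAnabelian.FreeProcyclicCohomology
import HarnessLib

/-!
# `H¹(G, B) ⥲ B/(γ − 1)B`, `[z] ↦ z(γ)`, for a free procyclic group `G` topologically generated by `γ`

abc-iut cell, layer L4.  Companion of `FreeProcyclicCohomology.lean`, which proves the COUNT
`#H¹(G, B) = #B^G` for a profinite group `G` with a dense cyclic subgroup `γ^ℤ` and an open subgroup of
every positive index (the cell's `FundamentalExtension.IsFreeProcyclic`, "`G ≅ Ẑ`", [AbsTopI] §0 p. 7;
[AbsTopIII] Prop. 1.4 (i) `I_x ≅ Ẑ(1)`) and a finite discrete `G`-module `B`.  Here the MAP: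

* `evalMod τ γ : H¹(G, B) →+ B ⧸ (γ − 1)B`, `[z] ↦ z(γ) mod (γ − 1)B` — well defined for ANY topological
  group, element `γ` and discrete module (a coboundary `σ ↦ σ v − v` evaluates to `(γ − 1) v`);
  `evalMod_oneCocycleClass`;
* `evalMod_bijective_of_dense_zpowers` — for `G ≅ Ẑ` generated by `γ` and `B` finite it is
  BIJECTIVE (injective: a cocycle inflated from a finite cyclic quotient is determined by its value at
  the generator; surjective: the geometric cocycle `σ ↦ Σ_{j<idx σ} γʲ b₀` of the tree's
  `FrobeniusQuotientHOne`), and the equivalence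
  **`H1EquivQuotientOfDenseZpowers : H¹(G, B) ≃+ B ⧸ (γ − 1)B`** with its `IsFreeProcyclic` /
  cuspidal-inertia (`I_x ≅ Ẑ(1)`, `InertiaFreeProcyclic`) forms — the structural version of
  "`H¹(Ẑ, B) = B/(F − 1)B`" (Serre, *Local Fields* XIII §1 Prop. 1; Milne, *ADT* I §2 Lemma 2.9).

HONEST FRAMING: classical; nothing here bears on [IUTchIII] Cor. 3.12 or takes a side.
-/

noncomputable section

open CategoryTheory Function

universe u

namespace Literature.AnabelianGeometry.AbsoluteAnabelian

open Literature.NumberTheory.GaloisRepresentations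
open _root_.TopRep _root_.ContRepresentation _root_.ContinuousCohomology _root_.Topology _root_.Filter

/-! ### The evaluation map `H¹(G, B) → B/(γ − 1)B` -/

section EvalMod

variable {G : Type u} [Group G] [TopologicalSpace G] [IsTopologicalGroup G]
variable {B : Type u} [AddCommGroup B] [TopologicalSpace B] [DiscreteTopology B]
variable (τ : ContinuousRep G ℤ B) (γ : G)

/-- `(γ − 1)B`, the image of `τ γ − 1`. [cite: SerreLocalFields1979, XIII §1 Prop. 1] -/
def subOneRange : AddSubgroup B := ((τ γ - 1 : B →ₗ[ℤ] B).toAddMonoidHom).range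

omit [IsTopologicalGroup G] [DiscreteTopology B] in
/-- Membership in `(γ − 1)B`. [cite: SerreLocalFields1979, XIII §1 Prop. 1] -/
theorem mem_subOneRange_iff (b : B) : b ∈ subOneRange τ γ ↔ ∃ v : B, τ γ v - v = b := by
  constructor
  · rintro ⟨v, hv⟩; exact ⟨v, hv⟩
  · rintro ⟨v, hv⟩; exact ⟨v, hv⟩

/-- Two cocycles with the same class have the same value at `γ` modulo `(γ − 1)B` (a coboundary
`σ ↦ σ v − v` evaluates to `(γ − 1)v`). [cite: SerreLocalFields1979, XIII §1 Prop. 1] -/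
theorem mk_apply_eq_of_oneCocycleClass_eq {z z' : contOneCocycles τ.toTopRep}
    (h : oneCocycleClass _ z = oneCocycleClass _ z') :
    (QuotientAddGroup.mk (z.1 γ) : B ⧸ subOneRange τ γ) = QuotientAddGroup.mk (z'.1 γ) := by
  have h0 : oneCocycleClass _ (z - z') = 0 := by rw [oneCocycleClass_sub, h, sub_self]
  obtain ⟨v, hv⟩ := (oneCocycleClass_eq_zero_iff _ _).1 h0
  rw [QuotientAddGroup.eq, mem_subOneRange_iff]
  refine ⟨-v, ?_⟩
  have e : z.1 γ - z'.1 γ = τ γ v - v := hv γ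
  rw [map_neg]
  have : -(z.1 γ) + z'.1 γ = -(z.1 γ - z'.1 γ) := by abel
  rw [this, e]
  abel

/-- **`evalMod τ γ : H¹(G, B) →+ B ⧸ (γ − 1)B`, `[z] ↦ z(γ)`** (well defined by
`mk_apply_eq_of_oneCocycleClass_eq`). [cite: SerreLocalFields1979, XIII §1 Prop. 1] -/
def evalMod : continuousCohomology 1 τ.toTopRep →+ B ⧸ subOneRange τ γ where
  toFun c := QuotientAddGroup.mk ((surjInv (oneCocycleClass_surjective τ.toTopRep) c).1 γ)
  map_zero' := by
    have h := mk_apply_eq_of_oneCocycleClass_eq τ γ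
      ((surjInv_eq (oneCocycleClass_surjective τ.toTopRep) (0 : continuousCohomology 1 τ.toTopRep)).trans
        (oneCocycleClass_zero τ.toTopRep).symm)
    rw [h]
    exact (QuotientAddGroup.eq_zero_iff _).mpr (AddSubgroup.zero_mem _)
  map_add' c d := by
    obtain ⟨z, rfl⟩ := oneCocycleClass_surjective _ c
    obtain ⟨z', rfl⟩ := oneCocycleClass_surjective _ d
    rw [mk_apply_eq_of_oneCocycleClass_eq τ γ (surjInv_eq (oneCocycleClass_surjective _) _),
      mk_apply_eq_of_oneCocycleClass_eq τ γ (surjInv_eq (oneCocycleClass_surjective _) _),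
      ← oneCocycleClass_add,
      mk_apply_eq_of_oneCocycleClass_eq τ γ (surjInv_eq (oneCocycleClass_surjective _) _)]
    rfl

/-- `evalMod [z] = z(γ) mod (γ − 1)B`. [cite: SerreLocalFields1979, XIII §1 Prop. 1] -/
@[simp] theorem evalMod_oneCocycleClass (z : contOneCocycles τ.toTopRep) :
    evalMod τ γ (oneCocycleClass _ z) = QuotientAddGroup.mk (z.1 γ) :=
  mk_apply_eq_of_oneCocycleClass_eq τ γ (surjInv_eq (oneCocycleClass_surjective _) _)

end EvalMod

/-! ### Bijectivity for `G ≅ Ẑ` and finite `B` -/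

section Procyclic

variable {G : Type u} [Group G] [TopologicalSpace G] [IsTopologicalGroup G] [CompactSpace G]
  [TotallyDisconnectedSpace G]
variable {B : Type u} [AddCommGroup B] [TopologicalSpace B] [DiscreteTopology B] [Finite B]

/-- **`[z] ↦ z(γ)` is bijective `H¹(G, B) → B/(γ − 1)B`** for `G ≅ Ẑ` topologically generated by `γ`
(dense `γ^ℤ`, an open subgroup of every positive index) and `B` finite.
[cite: SerreLocalFields1979, XIII §1 Prop. 1] -/
theorem evalMod_bijective_of_dense_zpowers {γ : G} (hγ : Dense (Subgroup.zpowers γ : Set G))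
    (hidx : ∀ n : ℕ, 0 < n → ∃ H : Subgroup G, IsOpen (H : Set G) ∧ H.index = n)
    (τ : ContinuousRep G ℤ B) : Bijective (evalMod τ γ) := by
  classical
  have hgen : ∀ (H : Subgroup G) [H.Normal], IsOpen (H : Set G) →
      ∀ r : G ⧸ H, ∃ i : ℕ, r = (QuotientGroup.mk γ : G ⧸ H) ^ i :=
    fun H _ hH r => exists_pow_eq_mk_of_dense_zpowers hγ H hH r
  constructor
  · -- injective: a cocycle with `z(γ) ∈ (γ − 1)B` is a coboundary
    intro c d hcd
    obtain ⟨z, rfl⟩ := oneCocycleClass_surjective _ c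
    obtain ⟨z', rfl⟩ := oneCocycleClass_surjective _ d
    rw [evalMod_oneCocycleClass, evalMod_oneCocycleClass, QuotientAddGroup.eq, mem_subOneRange_iff] at hcd
    obtain ⟨b₁, hb₁⟩ := hcd
    set w : contOneCocycles τ.toTopRep := z' - z - coboundaryCocycle τ b₁ with hwdef
    obtain ⟨H, hHn, hHo, -, hHw⟩ := exists_openNormal_invariant τ w
    haveI := hHn
    have hw0 : w = 0 := by
      refine contOneCocycles.eq_zero_of_apply_eq_zero γ H (hgen H hHo) w hHw ?_
      change z'.1 γ - z.1 γ - (τ γ b₁ - b₁) = 0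
      rw [hb₁]; abel
    have : oneCocycleClass _ z' - oneCocycleClass _ z = 0 := by
      rw [← oneCocycleClass_sub, show z' - z = w + coboundaryCocycle τ b₁ by rw [hwdef]; abel, hw0,
        zero_add, oneCocycleClass_coboundaryCocycle]
    exact (sub_eq_zero.1 this).symm
  · -- surjective: the geometric cocycle with value `b₀` at `γ`
    intro y
    obtain ⟨b₀, rfl⟩ := QuotientAddGroup.mk_surjective y
    obtain ⟨H₀, hH₀n, hH₀o, hH₀X, -⟩ := exists_openNormal_invariant τ 0
    haveI := hH₀n
    haveI : Finite (G ⧸ H₀) := Subgroup.quotient_finite_of_isOpen H₀ hH₀o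
    set n₀ : ℕ := orderOf (QuotientGroup.mk γ : G ⧸ H₀) with hn₀
    have hn₀pos : 0 < n₀ := orderOf_pos _
    set m : ℕ := Nat.card B * n₀ with hmdef
    have hm : 0 < m := Nat.mul_pos Nat.card_pos hn₀pos
    obtain ⟨U, hUo, hUi⟩ := hidx m hm
    obtain ⟨N, hNU⟩ := ProfiniteGrp.exist_openNormalSubgroup_sub_open_nhds_of_one hUo U.one_mem
    let H₁ : Subgroup G := H₀ ⊓ (N : Subgroup G)
    haveI : H₁.Normal := inferInstance
    have hH₁o : IsOpen (H₁ : Set G) := hH₀o.inter N.isOpen'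
    have hH₁₀ : H₁ ≤ H₀ := inf_le_left
    have hH₁U : H₁ ≤ U := fun g hg => hNU (inf_le_right (a := H₀) hg)
    haveI : Finite (G ⧸ H₁) := Subgroup.quotient_finite_of_isOpen H₁ hH₁o
    set n₁ : ℕ := orderOf (QuotientGroup.mk γ : G ⧸ H₁) with hn₁
    have hpow₁ : γ ^ n₁ ∈ H₁ := by
      rw [← QuotientGroup.eq_one_iff, QuotientGroup.mk_pow, hn₁]
      exact pow_orderOf_eq_one _
    have hn₁idx : n₁ = H₁.index := orderOf_mk_eq_index_of_dense_zpowers hγ H₁ hH₁o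
    have hmn₁ : m ∣ n₁ := by
      rw [hn₁idx, ← hUi]
      exact Subgroup.index_dvd_of_le hH₁U
    have hn₀₁ : n₀ ∣ n₁ := by
      rw [hn₀]
      apply orderOf_dvd_of_pow_eq_one
      rw [← QuotientGroup.mk_pow, QuotientGroup.eq_one_iff]
      exact hH₁₀ hpow₁
    obtain ⟨k, hk⟩ := hn₀₁
    have hNk : Nat.card B ∣ k := by
      have h := hmn₁
      rw [hk, hmdef, mul_comm (Nat.card B) n₀] at h
      exact Nat.dvd_of_mul_dvd_mul_left hn₀pos h
    have hγn₀ : ∀ x : B, τ.toTopRep.ρ (γ ^ n₀) x = x := fun x => by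
      rw [ContinuousRep.toTopRep_ρ_apply]
      refine hH₀X _ ?_ x
      rw [← QuotientGroup.eq_one_iff, QuotientGroup.mk_pow, hn₀]
      exact pow_orderOf_eq_one _
    have hN : geomSum (X := τ.toTopRep) γ b₀ (orderOf (QuotientGroup.mk γ : G ⧸ H₁)) = 0 := by
      rw [← hn₁, hk, geomSum_mul_eq_smul (X := τ.toTopRep) γ b₀ hγn₀ k]
      obtain ⟨k', rfl⟩ := hNk
      rw [mul_comm, mul_nsmul, card_nsmul_eq_zero']
    let z : contOneCocycles τ.toTopRep := geomCocycle γ b₀ H₁ (hgen H₁ hH₁o) hH₁o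
      (fun h hh x => by rw [ContinuousRep.toTopRep_ρ_apply]; exact hH₀X h (hH₁₀ hh) x) hN
    have hz : z.1 γ = b₀ := geomCocycle_apply_self (X := τ.toTopRep) γ b₀ H₁ (hgen H₁ hH₁o) hH₁o _ hN
    exact ⟨oneCocycleClass _ z, by rw [evalMod_oneCocycleClass, hz]⟩

/-- **`H¹(G, B) ≃+ B ⧸ (γ − 1)B`, `[z] ↦ z(γ)`**, for `G ≅ Ẑ` topologically generated by `γ` and `B`
finite. [cite: SerreLocalFields1979, XIII §1 Prop. 1] -/
def H1EquivQuotientOfDenseZpowers {γ : G} (hγ : Dense (Subgroup.zpowers γ : Set G))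
    (hidx : ∀ n : ℕ, 0 < n → ∃ H : Subgroup G, IsOpen (H : Set G) ∧ H.index = n)
    (τ : ContinuousRep G ℤ B) : continuousCohomology 1 τ.toTopRep ≃+ B ⧸ subOneRange τ γ :=
  AddEquiv.ofBijective (evalMod τ γ) (evalMod_bijective_of_dense_zpowers hγ hidx τ)

/-- `H1EquivQuotientOfDenseZpowers [z] = z(γ) mod (γ − 1)B`. [cite: SerreLocalFields1979, XIII §1 Prop. 1] -/
@[simp] theorem H1EquivQuotientOfDenseZpowers_oneCocycleClass {γ : G}
    (hγ : Dense (Subgroup.zpowers γ : Set G))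
    (hidx : ∀ n : ℕ, 0 < n → ∃ H : Subgroup G, IsOpen (H : Set G) ∧ H.index = n)
    (τ : ContinuousRep G ℤ B) (z : contOneCocycles τ.toTopRep) :
    H1EquivQuotientOfDenseZpowers hγ hidx τ (oneCocycleClass _ z) = QuotientAddGroup.mk (z.1 γ) :=
  evalMod_oneCocycleClass τ γ z

variable [T2Space G] in
/-- **`H¹(G, B) ≃+ B ⧸ (γ − 1)B` for a free procyclic profinite group and any topological generator
`γ`.** [cite: SerreLocalFields1979, XIII §1 Prop. 1] -/
def FundamentalExtension.IsFreeProcyclic.H1EquivQuotient (h : FundamentalExtension.IsFreeProcyclic G)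
    {γ : G} (hγ : Dense (Subgroup.zpowers γ : Set G)) (τ : ContinuousRep G ℤ B) :
    continuousCohomology 1 τ.toTopRep ≃+ B ⧸ subOneRange τ γ :=
  H1EquivQuotientOfDenseZpowers hγ h.exists_isOpen_index τ

end Procyclic

/-! ### Cuspidal inertia groups `I_x ≅ Ẑ(1)` -/

namespace FundamentalExtension.CuspidalData

variable {E : FundamentalExtension.{u}} (C : E.CuspidalData)

/-- **`H¹(I_x, B) ≃+ B ⧸ (γ − 1)B`** for a cuspidal inertia group `I_x ≅ Ẑ(1)` (`InertiaFreeProcyclic`),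
a topological generator `γ` of `I_x` and a finite discrete `I_x`-module `B`.
[cite: MochizukiAbsTopIII2015, Prop 1.4 (i) p.31] -/
def H1EquivQuotientIcusp (hC : InertiaFreeProcyclic C) (x : C.Cusp) {γ : C.Icusp x}
    (hγ : Dense (Subgroup.zpowers γ : Set (C.Icusp x)))
    {B : Type u} [AddCommGroup B] [TopologicalSpace B] [DiscreteTopology B] [Finite B]
    (τ : ContinuousRep (C.Icusp x) ℤ B) :
    continuousCohomology 1 τ.toTopRep ≃+ B ⧸ subOneRange τ γ :=
  haveI := C.compactSpace_Icusp x
  (hC x).H1EquivQuotient hγ τ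

end FundamentalExtension.CuspidalData

end Literature.AnabelianGeometry.AbsoluteAnabelian

end
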